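import Literature.Geometry.Kaehler.AnalyticSetOpenProjection
import Literature.Geometry.Kaehler.ComplexTorusAnalyticCycleClass
import Literature.Geometry.Kaehler.ComplexTorusHomLift
import HarnessLib

/-!
# Small translates: `Y₁ ∩ (Y₂ − t)` approximates `Y₁ ∩ Y₂` at its points of the expected dimension

Layer `Literature/Geometry/Kaehler`; lane `lit-hodgefound`, seat p07, programme «REMMERT'S OPEN MAPPING
THEOREM AND THE POSITIVITY OF INTERSECTION MULTIPLICITIES», file 2. Let `X = E/Λ` be a complex torus
of dimension `g`, `Y₁, Y₂ ⊆ X` closed analytic subsets of pure dimensions `d₁, d₂`, and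
`r = d₁ + d₂ − g ≥ 0` the expected dimension of `Y₁ ∩ Y₂`. In Fulton's dynamic construction of the
intersection product ([Fulton1998, §11.1]: the limit cycle `lim_{t → 0} [Y₁ ∩ (Y₂ − t)]` along the
translates by a group acting transitively, Example 11.4.5) the components `C` of `Y₁ ∩ Y₂` of the
expected dimension are "proper components", and along them the intersection multiplicity is positive
([Fulton1998, §7.1 Prop. 7.1 (a)]: "If `β` is a proper component of `W ∩ V`, then
`1 ≤ i(β) ≤ l(𝒪_{β, W ∩ V})`"). Analytically, the positivity rests on the following continuity
statement, proved here:

* **`ComplexTorus.eventually_nonempty_inter_preimage_add`** — if `z ∈ Y₁ ∩ Y₂` and `Y₁ ∩ Y₂` has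
  dimension `≤ r` at `z` (all regular points of `Y₁ ∩ Y₂` near `z` have codimension `≥ g − r`), then
  for every neighbourhood `U` of `z` and all sufficiently small `t ∈ X` the set `U ∩ Y₁ ∩ (Y₂ − t)` is
  non-empty. This is REMMERT'S OPEN MAPPING THEOREM ([Fischer1976, §3.9 Prop.]: a holomorphic map of a
  pure `m`-dimensional space to an `n`-manifold with fibre dimension `m − n` at `p` is open at `p`) for
  the subtraction map `σ : Y₁ × Y₂ → X`, `σ(x, y) = y − x`, at `(z, z)`: `Y₁ × Y₂` has pure dimension
  `d₁ + d₂`, the fibre `σ⁻¹(0) ≅ Y₁ ∩ Y₂` (the diagonal section) has dimension `≤ r = (d₁ + d₂) − g` at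
  `(z, z)`, so `σ((U ∩ Y₁) × Y₂)` is a neighbourhood of `0`, i.e. for `t` near `0` there are `x ∈ U ∩ Y₁`,
  `y ∈ Y₂` with `y − x = t`. We apply the linear case `SCV.image_inter_mem_nhds_of_section`
  (`AnalyticSetOpenProjection`) to the lifts `π⁻¹Y₁ × π⁻¹Y₂ ⊆ E × E`, the linear surjection
  `(x, y) ↦ y − x` and the diagonal parametrisation `v ↦ (v, v)` of its kernel, and push down by the
  open map `π`;
* `ComplexTorus.eventually_nonempty_inter_preimage_add_of_hasPureDim` — the same at every point of a
  PROPER intersection (`Y₁ ∩ Y₂` of pure dimension `r`);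
* `ComplexTorus.mem_closure_iUnion_inter_preimage_add` (`…_of_hasPureDim`) — limit-set form: for
  `t_j → 0`, such a `z` lies in `closure (⋃_{j ≥ N} Y₁ ∩ (Y₂ − t_j))` for every `N` (the input of the
  limit-cycle description `exists_subseq_effectiveCycle_of_measure_le` of the intersection cycle).

Preliminaries: §1 `SCV.isRegPt_prod_of_pure` (model space: the regular points of a product of sets
with all regular points of codimensions `c₁`, `c₂` have codimension `c₁ + c₂`,
[Chirka1989, §3.5, proof of Prop. 2]); §2 `ComplexTorus.isZeroSetAt_cover_preimage`,
`ComplexTorus.isRegPt_cover_preimage_of_hasPureDim` (the lift `π⁻¹Y ⊆ E` in the model-space vocabulary).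
Theorems only; no definitions, no named facts.

## References

* [Fulton1998] W. Fulton, *Intersection Theory*, 2nd ed., Springer 1998, §7.1 Prop. 7.1 (a), §11.1,
  Example 11.4.5.
* [Fischer1976] G. Fischer, *Complex Analytic Geometry*, LNM 538, Springer 1976, §3.2 Thm., §3.9 Prop.
  (held `book:fischer1976-complex-analytic-geometry`, PDF p0159, p0165–0166).
* [Chirka1989] E. M. Chirka, *Complex Analytic Sets*, Kluwer 1989, §2.3, §3.5 Prop. 2 (p. 36).
* [Lange2023AbelianVarietiesComplex] H. Lange, *Abelian Varieties over the Complex Numbers*, Springer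
  2023, §1.1.4 (the covering `π : E → X`).
-/

noncomputable section

open scoped Topology Manifold
open Set Filter Metric Function
open Literature.Analysis.Complex.SCV (IsZeroSetAt)
open Literature.AlgebraicGeometry.Motives (mem_closure_regLocus)

namespace Literature.Geometry.Kaehler

/-! ### §1 Model space: regular points of a product of pure-codimensional sets -/

namespace SCV

variable {E : Type*} [NormedAddCommGroup E] [NormedSpace ℂ E] [FiniteDimensional ℂ E]
  {F : Type*} [NormedAddCommGroup F] [NormedSpace ℂ F] [FiniteDimensional ℂ F]

/-- **`dim (A₁ × A₂) = dim A₁ + dim A₂` at every regular point** (model space): if `A₁ ⊆ E`, `A₂ ⊆ F`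
are cut out by holomorphic equations near each of their points and all regular points of `A_i` have
codimension `c_i`, then all regular points of `A₁ ×ˢ A₂` have codimension `c₁ + c₂`. Near a regular
point `x` of codimension `q` all points of the product are regular of codimension `q`
(`IsRegPt.eventually_isRegPt`); among them is a product `(y₁, y₂)` of regular points (regular points
are dense, [Chirka1989, §2.3 Thm.]), regular of codimension `c₁ + c₂` (`IsRegPt.prod`); so
`q = c₁ + c₂`. [cite: Chirka1989, §3.5 (proof of Prop. 2), p. 36; §2.3] -/
theorem isRegPt_prod_of_pure {A₁ : Set E} {A₂ : Set F} {c₁ c₂ : ℕ}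
    (hA₁ : ∀ x ∈ A₁, IsZeroSetAt A₁ x) (hA₂ : ∀ x ∈ A₂, IsZeroSetAt A₂ x)
    (h₁ : ∀ x ∈ regLocus A₁, IsRegPt A₁ c₁ x) (h₂ : ∀ x ∈ regLocus A₂, IsRegPt A₂ c₂ x) :
    ∀ x ∈ regLocus (A₁ ×ˢ A₂), IsRegPt (A₁ ×ˢ A₂) (c₁ + c₂) x := by
  rintro ⟨x₁, x₂⟩ ⟨⟨hx₁, hx₂⟩, q, hq⟩
  -- product-regular points accumulate at `(x₁, x₂)`
  have hcl : ((x₁, x₂) : E × F) ∈ closure (regLocus A₁ ×ˢ regLocus A₂) := by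
    rw [closure_prod_eq]
    exact ⟨mem_closure_regLocus (hA₁ x₁ hx₁) hx₁, mem_closure_regLocus (hA₂ x₂ hx₂) hx₂⟩
  have hfr : ∃ᶠ y in 𝓝 ((x₁, x₂) : E × F), y ∈ regLocus A₁ ×ˢ regLocus A₂ :=
    mem_closure_iff_frequently.1 hcl
  obtain ⟨⟨y₁, y₂⟩, ⟨hy₁, hy₂⟩, hyq⟩ := (hfr.and_eventually hq.eventually_isRegPt).exists
  have hysum : IsRegPt (A₁ ×ˢ A₂) (c₁ + c₂) (y₁, y₂) := (h₁ y₁ hy₁).prod (h₂ y₂ hy₂)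
  have hqe : q = c₁ + c₂ := IsRegPt.codim_unique (mk_mem_prod hy₁.1 hy₂.1) hyq hysum
  rw [← hqe]
  exact hq

end SCV

/-! ### §2 The lift `π⁻¹Y ⊆ E` in the model-space vocabulary -/

namespace ComplexTorus

open Literature.Geometry.Kaehler.SCV

variable {ι : Type*} [Fintype ι] {E : Type*} [NormedAddCommGroup E] [NormedSpace ℂ E]
  [FiniteDimensional ℂ E] (Φ : (ι → ℝ) ≃L[ℝ] E)

omit [FiniteDimensional ℂ E] in
/-- **`π⁻¹Y` is cut out by holomorphic equations near every point of `E`** for a closed analytic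
`Y ⊆ X` (`π` is holomorphic). [cite: Chirka1989, §2.1] [cite: Lange2023AbelianVarietiesComplex, §1.1.4] -/
theorem isZeroSetAt_cover_preimage {Y : Set (ComplexTorus Φ)} (hY : IsAnalyticSet 𝓘(ℂ, E) Y) (x : E) :
    IsZeroSetAt (cover Φ ⁻¹' Y) x :=
  Literature.Analysis.Complex.SCV.isZeroSetAt_iff_isAnalyticSetAt.2 ((hY.preimage (mdifferentiable_cover Φ)) x)

omit [FiniteDimensional ℂ E] in
/-- **The regular points of `π⁻¹Y` have codimension `g − d`** for `Y ⊆ X` of pure dimension `d`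
(`π` is a local biholomorphism, `isRegularPointOfCodim_cover_preimage_iff`).
[cite: Chirka1989, §2.3] [cite: Lange2023AbelianVarietiesComplex, §1.1.4] -/
theorem isRegPt_cover_preimage_of_hasPureDim {Y : Set (ComplexTorus Φ)} {d : ℕ}
    (hY : HasPureDim 𝓘(ℂ, E) Y d) :
    ∀ x ∈ regLocus (cover Φ ⁻¹' Y), IsRegPt (cover Φ ⁻¹' Y) (Module.finrank ℂ E - d) x := by
  rintro x ⟨hxY, q, hq⟩
  obtain ⟨-, -, hreg⟩ := hY.hasPureCodim
  have hq' : IsRegularPointOfCodim 𝓘(ℂ, E) Y q (cover Φ x) :=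
    (isRegularPointOfCodim_cover_preimage_iff Φ x).1 (isRegularPointOfCodim_iff_isRegPt.2 hq)
  have h := hreg (cover Φ x) ⟨hxY, q, hq'⟩
  exact isRegularPointOfCodim_iff_isRegPt.1 ((isRegularPointOfCodim_cover_preimage_iff Φ x).2 h)

/-! ### §3 Small translates of `Y₂` meet `Y₁` near every point of `Y₁ ∩ Y₂` of the expected dimension -/

/-- **`U ∩ Y₁ ∩ (Y₂ − t) ≠ ∅` for all small `t`**, at a point `z ∈ Y₁ ∩ Y₂` where `Y₁ ∩ Y₂` has the
expected dimension. Let `Y₁, Y₂ ⊆ X` be closed analytic of pure dimensions `d₁, d₂`, `r + g = d₁ + d₂`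
(`r` the expected dimension of `Y₁ ∩ Y₂`), `z ∈ Y₁ ∩ Y₂`, and suppose all regular points of `Y₁ ∩ Y₂`
near `z` have codimension `≥ g − r` (`dim_z (Y₁ ∩ Y₂) ≤ r`, hence `= r` by [Chirka1989, §3.5 Prop. 2]).
Then for every neighbourhood `U` of `z`: for all `t` near `0` in `X` there is `x ∈ U ∩ Y₁` with
`x + t ∈ Y₂`. This is Remmert's open mapping theorem ([Fischer1976, §3.9 Prop.]) for the subtraction
map `σ(x, y) = y − x` on `Y₁ × Y₂` (pure dimension `d₁ + d₂`) at `(z, z)`, whose fibre `σ⁻¹(0)` is the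
diagonal copy of `Y₁ ∩ Y₂`: `σ((U ∩ Y₁) × Y₂)` is a neighbourhood of `0`. (Proof on the universal
cover: `SCV.image_inter_mem_nhds_of_section` for `π⁻¹Y₁ × π⁻¹Y₂ ⊆ E × E`, the linear surjection
`(x, y) ↦ y − x` and the diagonal section `{v | z̃ + v ∈ π⁻¹(Y₁ ∩ Y₂)}`, then the open map `π`.)
[cite: Fischer1976, §3.9 Prop. and Cor. 2] [cite: Fulton1998, §11.1 and Example 11.4.5]
[cite: Chirka1989, §3.5 Prop. 2, p. 36] -/
theorem eventually_nonempty_inter_preimage_add {Y₁ Y₂ : Set (ComplexTorus Φ)} {d₁ d₂ r : ℕ}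
    (hY₁ : HasPureDim 𝓘(ℂ, E) Y₁ d₁) (hY₂ : HasPureDim 𝓘(ℂ, E) Y₂ d₂)
    (hr : r + Module.finrank ℂ E = d₁ + d₂) {z : ComplexTorus Φ} (hz : z ∈ Y₁ ∩ Y₂)
    (hdim : ∀ᶠ x in 𝓝 z, x ∈ Y₁ ∩ Y₂ → ∀ q, IsRegularPointOfCodim 𝓘(ℂ, E) (Y₁ ∩ Y₂) q x →
      Module.finrank ℂ E ≤ q + r)
    {U : Set (ComplexTorus Φ)} (hU : U ∈ 𝓝 z) :
    ∀ᶠ t in 𝓝 (0 : ComplexTorus Φ), (U ∩ Y₁ ∩ (fun x ↦ x + t) ⁻¹' Y₂).Nonempty := by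
  classical
  -- lift to the universal cover
  obtain ⟨a, rfl⟩ := cover_surjective Φ z
  set A₁ : Set E := cover Φ ⁻¹' Y₁ with hA₁def
  set A₂ : Set E := cover Φ ⁻¹' Y₂ with hA₂def
  have hA₁ : ∀ x, IsZeroSetAt A₁ x := isZeroSetAt_cover_preimage Φ hY₁.isAnalyticSet
  have hA₂ : ∀ x, IsZeroSetAt A₂ x := isZeroSetAt_cover_preimage Φ hY₂.isAnalyticSet
  have hp₁ := isRegPt_cover_preimage_of_hasPureDim Φ hY₁
  have hp₂ := isRegPt_cover_preimage_of_hasPureDim Φ hY₂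
  have hd₁ := hY₁.le_finrank
  have hd₂ := hY₂.le_finrank
  -- the product `π⁻¹Y₁ × π⁻¹Y₂ ⊆ E × E`, of pure codimension `(g - d₁) + (g - d₂)`
  set A : Set (E × E) := A₁ ×ˢ A₂ with hAdef
  have hA : ∀ x ∈ (univ : Set (E × E)), IsZeroSetAt A x := fun x _ => (hA₁ x.1).prod (hA₂ x.2)
  have hpure' : ∀ x ∈ regLocus A, IsRegPt A ((Module.finrank ℂ E - d₁) + (Module.finrank ℂ E - d₂)) x :=
    SCV.isRegPt_prod_of_pure (fun x _ => hA₁ x) (fun x _ => hA₂ x) hp₁ hp₂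
  have hrankVV : Module.finrank ℂ (E × E) = Module.finrank ℂ E + Module.finrank ℂ E :=
    Module.finrank_prod
  have hm : d₁ + d₂ ≤ Module.finrank ℂ (E × E) := by omega
  have hpure : ∀ x ∈ regLocus A, IsRegPt A (Module.finrank ℂ (E × E) - (d₁ + d₂)) x := by
    have h : Module.finrank ℂ (E × E) - (d₁ + d₂) =
        (Module.finrank ℂ E - d₁) + (Module.finrank ℂ E - d₂) := by omega
    rw [h]
    exact hpure'
  have haA : ((a, a) : E × E) ∈ A := ⟨hz.1, hz.2⟩
  -- the subtraction map and the diagonal parametrisation of its kernel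
  set ℓ : E × E →L[ℂ] E := ContinuousLinearMap.snd ℂ E E - ContinuousLinearMap.fst ℂ E E with hℓdef
  have hℓapply : ∀ x : E × E, ℓ x = x.2 - x.1 := fun x => rfl
  have hℓ : Function.Surjective ℓ := fun v => ⟨(0, v), by rw [hℓapply, sub_zero]⟩
  set κ : E →L[ℂ] E × E := (ContinuousLinearMap.id ℂ E).prod (ContinuousLinearMap.id ℂ E) with hκdef
  have hκapply : ∀ v : E, κ v = (v, v) := fun v => rfl
  have hκ : Function.Injective κ := fun v w h => congrArg Prod.fst h
  have hκℓ : ∀ w, ℓ (κ w) = 0 := fun w => by rw [hκapply, hℓapply, sub_self]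
  have hrank : Module.finrank ℂ E + Module.finrank ℂ E = Module.finrank ℂ (E × E) := hrankVV.symm
  -- the diagonal section of `A` at `(a, a)` is the translate of `π⁻¹(Y₁ ∩ Y₂)`
  have hsecset : {w : E | (a, a) + κ w ∈ A} = {v : E | a + v ∈ A₁ ∩ A₂} := by
    ext v
    simp [hκapply, hAdef, mem_prod]
  have hcont : Continuous fun v : E => cover Φ (a + v) := (continuous_cover Φ).comp (continuous_const.add continuous_id)
  have htend : Tendsto (fun v : E => cover Φ (a + v)) (𝓝 0) (𝓝 (cover Φ a)) := by
    have := hcont.tendsto 0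
    rwa [add_zero] at this
  have hsec : ∀ᶠ w in 𝓝 (0 : E), (a, a) + κ w ∈ A → ∀ q, IsRegPt {w : E | (a, a) + κ w ∈ A} q w →
      Module.finrank ℂ E ≤ q + r := by
    rw [hsecset]
    filter_upwards [htend.eventually hdim] with v hv hvA q hq
    have hvA' : a + v ∈ A₁ ∩ A₂ := by simpa [hκapply, hAdef, mem_prod] using hvA
    refine hv hvA' q ?_
    have h1 : IsRegPt (A₁ ∩ A₂) q (a + v) := isRegPt_preimage_add_iff.1 hq
    have h2 : IsRegularPointOfCodim 𝓘(ℂ, E) (cover Φ ⁻¹' (Y₁ ∩ Y₂)) q (a + v) :=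
      isRegularPointOfCodim_iff_isRegPt.2 h1
    exact (isRegularPointOfCodim_cover_preimage_iff Φ (a + v)).1 h2
  -- Remmert's open mapping theorem for `ℓ` on `A` at `(a, a)`, with the neighbourhood `π⁻¹U × E`
  have hU' : (cover Φ ⁻¹' U) ×ˢ (univ : Set E) ∈ 𝓝 ((a, a) : E × E) :=
    prod_mem_nhds ((continuous_cover Φ).continuousAt.preimage_mem_nhds hU) univ_mem
  have hmain := SCV.image_inter_mem_nhds_of_section hℓ κ hκ hκℓ hrank isOpen_univ (subset_univ A) hA
    haA hm hpure hr hsec hU'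
  have hℓa : ℓ (a, a) = 0 := by rw [hℓapply, sub_self]
  rw [hℓa] at hmain
  -- push down by the open map `π`
  have hopen : IsOpenMap (cover Φ) := (isOpenQuotientMap_cover (Φ := Φ)).isOpenMap
  have h2 := hopen.image_mem_nhds hmain
  rw [cover_zero] at h2
  filter_upwards [h2] with t ht
  obtain ⟨s, ⟨⟨x, y⟩, ⟨⟨hx, hy⟩, hxU, -⟩, rfl⟩, rfl⟩ := ht
  refine ⟨cover Φ x, ⟨hxU, hx⟩, ?_⟩
  rw [mem_preimage, hℓapply, ← cover_add, add_sub_cancel]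
  exact hy

/-- **Proper intersections: `U ∩ Y₁ ∩ (Y₂ − t) ≠ ∅` for all small `t`, at every point of `Y₁ ∩ Y₂`**
— the previous theorem when `Y₁ ∩ Y₂` has the expected pure dimension `r = d₁ + d₂ − g` (every regular
point of `Y₁ ∩ Y₂` has codimension `g − r`). [cite: Fischer1976, §3.9 Prop. and Cor. 2]
[cite: Fulton1998, §7.1 Prop. 7.1 (a), §11.1 and Example 11.4.5] -/
theorem eventually_nonempty_inter_preimage_add_of_hasPureDim {Y₁ Y₂ : Set (ComplexTorus Φ)}
    {d₁ d₂ r : ℕ} (hY₁ : HasPureDim 𝓘(ℂ, E) Y₁ d₁) (hY₂ : HasPureDim 𝓘(ℂ, E) Y₂ d₂)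
    (hr : r + Module.finrank ℂ E = d₁ + d₂) (hI : HasPureDim 𝓘(ℂ, E) (Y₁ ∩ Y₂) r)
    {z : ComplexTorus Φ} (hz : z ∈ Y₁ ∩ Y₂) {U : Set (ComplexTorus Φ)} (hU : U ∈ 𝓝 z) :
    ∀ᶠ t in 𝓝 (0 : ComplexTorus Φ), (U ∩ Y₁ ∩ (fun x ↦ x + t) ⁻¹' Y₂).Nonempty := by
  refine eventually_nonempty_inter_preimage_add Φ hY₁ hY₂ hr hz (Eventually.of_forall ?_) hU
  intro x hx q hq
  obtain ⟨c, hc, -, -, hreg⟩ := hI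
  have h := (hreg x ⟨hx, q, hq⟩).codim_unique hx hq
  omega

/-- **Limit-set form: every point of `Y₁ ∩ Y₂` of the expected dimension is a limit point of
`Y₁ ∩ (Y₂ − t_j)`, `t_j → 0`.** Under the hypotheses of `eventually_nonempty_inter_preimage_add`, for
every sequence `t_j → 0` in `X` and every `N`, `z ∈ closure (⋃_{j ≥ N} Y₁ ∩ (Y₂ − t_j))` (the limit set
of [Chirka1989, §15.5] along the translates contains `z`). [cite: Fulton1998, §11.1 (the limit cycle is
supported on the proper components)] [cite: Fischer1976, §3.9 Prop.] -/
theorem mem_closure_iUnion_inter_preimage_add {Y₁ Y₂ : Set (ComplexTorus Φ)} {d₁ d₂ r : ℕ}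
    (hY₁ : HasPureDim 𝓘(ℂ, E) Y₁ d₁) (hY₂ : HasPureDim 𝓘(ℂ, E) Y₂ d₂)
    (hr : r + Module.finrank ℂ E = d₁ + d₂) {z : ComplexTorus Φ} (hz : z ∈ Y₁ ∩ Y₂)
    (hdim : ∀ᶠ x in 𝓝 z, x ∈ Y₁ ∩ Y₂ → ∀ q, IsRegularPointOfCodim 𝓘(ℂ, E) (Y₁ ∩ Y₂) q x →
      Module.finrank ℂ E ≤ q + r)
    {t : ℕ → ComplexTorus Φ} (ht : Tendsto t atTop (𝓝 0)) (N : ℕ) :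
    z ∈ closure (⋃ j ≥ N, Y₁ ∩ (fun x ↦ x + t j) ⁻¹' Y₂) := by
  rw [mem_closure_iff_nhds]
  intro U hU
  have hev := ht.eventually (eventually_nonempty_inter_preimage_add Φ hY₁ hY₂ hr hz hdim hU)
  obtain ⟨j, hj, hjN⟩ := (hev.and (eventually_ge_atTop N)).exists
  obtain ⟨x, ⟨hxU, hx₁⟩, hx₂⟩ := hj
  refine ⟨x, hxU, ?_⟩
  simp only [mem_iUnion, mem_inter_iff, mem_preimage, exists_prop]
  exact ⟨j, hjN, hx₁, hx₂⟩

/-- **Limit-set form for proper intersections**: if `Y₁ ∩ Y₂` has the expected pure dimension `r`, then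
for `t_j → 0` every point of `Y₁ ∩ Y₂` lies in `closure (⋃_{j ≥ N} Y₁ ∩ (Y₂ − t_j))` for all `N`.
[cite: Fulton1998, §7.1 Prop. 7.1 (a) and §11.1] [cite: Fischer1976, §3.9 Prop.] -/
theorem mem_closure_iUnion_inter_preimage_add_of_hasPureDim {Y₁ Y₂ : Set (ComplexTorus Φ)}
    {d₁ d₂ r : ℕ} (hY₁ : HasPureDim 𝓘(ℂ, E) Y₁ d₁) (hY₂ : HasPureDim 𝓘(ℂ, E) Y₂ d₂)
    (hr : r + Module.finrank ℂ E = d₁ + d₂) (hI : HasPureDim 𝓘(ℂ, E) (Y₁ ∩ Y₂) r)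
    {z : ComplexTorus Φ} (hz : z ∈ Y₁ ∩ Y₂) {t : ℕ → ComplexTorus Φ} (ht : Tendsto t atTop (𝓝 0))
    (N : ℕ) : z ∈ closure (⋃ j ≥ N, Y₁ ∩ (fun x ↦ x + t j) ⁻¹' Y₂) := by
  refine mem_closure_iUnion_inter_preimage_add Φ hY₁ hY₂ hr hz (Eventually.of_forall ?_) ht N
  intro x hx q hq
  obtain ⟨c, hc, -, -, hreg⟩ := hI
  have h := (hreg x ⟨hx, q, hq⟩).codim_unique hx hq
  omega

end ComplexTorus

end Literature.Geometry.Kaehler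

end
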